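import Summits.BirchSwinnertonDyer.BirchSwinnertonDyer.Theses.GoldfeldAllTwistsTwoConverse
import Summits.BirchSwinnertonDyer.BirchSwinnertonDyer.Theorems.GoldfeldAllTwistsTwoConverseTwinAdditiveBaseTwists
import Summits.BirchSwinnertonDyer.BirchSwinnertonDyer.Theorems.GoldfeldK12AdditiveTwoBaseChange
import HarnessLib

set_option linter.dupNamespace false
set_option autoImplicit false

/-!
# Crux K12₂″ as the rank-one `2`-converse for the three WILD twists `χ_ε`, `ε ∈ {−1, 2, −2}`, of the
# GOOD-ordinary `ℚ(√−7)` family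

Cell `bsd-goldfeld`, prover seat `s1p-c201` (gen 2), item `stmt-BirchSwinnertonDyer-20044` (K12₂″ =
`Theses.GoldfeldAllTwistsTwoConverse.RankOneTwoConverseCMSevenAdditiveTwo`). OPEN; nothing asserted.

The dictionary of the cell memo K12PP-LEAF §2 / K12PP-ODDPRIME (O1), made kernel: every curve of the additive
cell is, up to `ℚ`-isomorphism, `(X₀(49)^{(m)})^{(ε)}` with `m ≡ 1 (mod 4)` squarefree — a GOOD-at-`2`
member `E_m = X₀(49)^{(m)}` of the family (rung S1) — twisted by one of the three characters `χ_ε`,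
`ε ∈ {−1, 2, −2}`, of `2`-power conductor (`ℚ(i) ⊂ ℚ(μ₄)`, `ℚ(√±2) ⊂ ℚ(μ₈)`): on Hecke characters of
`𝒦 = ℚ(√−7)`, `ψ_W = ψ_{E_m} · (χ_ε ∘ N_{𝒦/ℚ})`, where `χ_ε ∘ N` is a quadratic RING-CLASS character of `𝒦`
of conductor `4` or `8` — the form in which a two-variable / anticyclotomic argument over `𝒦` (Fan–Wan
arXiv:2304.09806v2 §7: auxiliary pair `(ξ, χ)` with `ξ` unramified at `2`) reads the additive cell.

* `rankOneTwoConverseCMSevenAdditiveTwo_iff_wildTwistsOfGoodFamily` (HYPOTHESIS-FREE `Iff`): K12₂″ ⟺ for every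
  squarefree `m ≡ 1 (mod 4)`, every `ε ∈ {−1, 2, −2}` and every globally minimal `W ≅_ℚ (cm7^{(m)})^{(ε)}`:
  `corank_{ℤ₂} Sel_{2^∞}(W/ℚ) = 1 ⟹ ord_{s=1} L(W, s) = 1`. Ingredients (tree theorems): c301's
  `exists_baseTwist_of_j_neg3375_of_not_good_two` (cell ⟹ `W ≅ (cm7^{(ε)})^{(m)}`), `quadraticTwist_quadraticTwist`
  (twisting is multiplicative on the nose), `j_quadraticTwist`/`j_cm7`/`variableChange_j` (`j(W) = −3375`),
  and g0's `not_hasGoodReductionAtPrime_two_of_smul_eq_quadraticTwist` (Barrios et al. 2025 rows `I₀`: a twist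
  by `εm ≡ 2, 3 (mod 4)` of the good curve `cm7` is not good at `2`).
* `hasGoodReductionAtPrime_two_of_smul_eq_quadraticTwist_cm7`: the family member is GOOD at `2` — every
  globally minimal `E ≅ cm7^{(m)}`, `m ≡ 1 (mod 4)`, has good reduction at `2` (tree theorem
  `hasGoodReductionAtPrime_and_frobeniusTrace_of_smul_eq_quadraticTwist_two`, Silverman VII / App. A), so the
  additive cell is exactly {wild quadratic twists of the good cell}.

No `sorry`, no definition, no instance, no notation, no fact binder.

References: [BarriosEtAl2025] Thm. 5.1; [SilvermanAEC2009] X.5 Cor. 5.4, VII.5; [FanWan2023] §7 (claim; context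
only); cell memos K12PP-LEAF §2, K12PP-ODDPRIME §3 (O1).
-/

noncomputable section

open scoped Classical

open WeierstrassCurve Literature.NumberTheory.EllipticCurves

namespace Summit.BirchSwinnertonDyer.BirchSwinnertonDyer.Theorems.GoldfeldGoodTwists

/-! ## §1 Bookkeeping: `j`, reduction at `2`, and the order of the two twists -/

/-- `(cm7^{(ε)})^{(m)} = (cm7^{(m)})^{(ε)}` — both are `cm7^{(εm)}` on the nose
(`quadraticTwist_quadraticTwist`). [folklore] -/
theorem quadraticTwist_cm7_comm (ε m : ℤ) :
    (cm7.quadraticTwist (ε : ℚ)).quadraticTwist (m : ℚ) =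
      (cm7.quadraticTwist (m : ℚ)).quadraticTwist (ε : ℚ) := by
  rw [quadraticTwist_quadraticTwist, quadraticTwist_quadraticTwist, mul_comm]

/-- A curve `ℚ`-isomorphic to a twist `cm7^{(n)}`, `n ≠ 0`, has `j = −3375`. [cite: SilvermanAEC2009, X.5 Cor. 5.4 and III.1 Prop. 1.4(b)] -/
theorem j_eq_neg3375_of_smul_eq_quadraticTwist_cm7 (W : WeierstrassCurve ℚ) [W.IsElliptic] {n : ℤ}
    (hn : n ≠ 0) {C : VariableChange ℚ} (hC : C • W = cm7.quadraticTwist (n : ℚ)) : W.j = -3375 := by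
  have hn' : (n : ℚ) ≠ 0 := by exact_mod_cast hn
  have key : ∀ (V : WeierstrassCurve ℚ) [V.IsElliptic], V = cm7.quadraticTwist (n : ℚ) → V.j = -3375 := by
    intro V _ hV
    subst hV
    rw [j_quadraticTwist cm7 hn', j_cm7]
  have hj := key (C • W) hC
  rwa [variableChange_j] at hj

/-- **The family member is GOOD at `2`.** Every globally minimal `E ≅_ℚ cm7^{(m)}` with `m ≡ 1 (mod 4)` has
good reduction at `2` (the twisting character `χ_m` is unramified at `2`; tree theorem
`hasGoodReductionAtPrime_and_frobeniusTrace_of_smul_eq_quadraticTwist_two`). [cite: SilvermanAEC2009, VII.5 Prop. 5.1(a) and App. A Prop. A.1.1] -/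
theorem hasGoodReductionAtPrime_two_of_smul_eq_quadraticTwist_cm7 (E : WeierstrassCurve ℚ)
    [E.IsGloballyMinimal] {m : ℤ} (hm : m % 4 = 1) {C : VariableChange ℚ}
    (hC : C • E = cm7.quadraticTwist (m : ℚ)) : E.HasGoodReductionAtPrime 2 :=
  haveI : Fact (2 : ℕ).Prime := ⟨Nat.prime_two⟩
  (hasGoodReductionAtPrime_and_frobeniusTrace_of_smul_eq_quadraticTwist_two cm7 E hm hC 2 rfl
    hasGoodReductionAtPrime_cm7_two).1

/-- **The wild twist is NOT good at `2`.** A globally minimal `W ≅_ℚ (cm7^{(m)})^{(ε)}` with `m ≡ 1 (mod 4)`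
and `ε ∈ {−1, 2, −2}` is not good at `2` (`εm ≡ 3, 2, 2 (mod 4)`; Barrios et al. 2025 Thm. 5.1 rows `I₀` via
g0's `not_hasGoodReductionAtPrime_two_of_smul_eq_quadraticTwist`). [cite: BarriosEtAl2025, Thm. 5.1 (rows R = I₀)] -/
theorem not_hasGoodReductionAtPrime_two_of_smul_eq_wildTwist (W : WeierstrassCurve ℚ) [W.IsElliptic]
    {ε m : ℤ} (hε : ε = -1 ∨ ε = 2 ∨ ε = -2) (hm : m % 4 = 1) {C : VariableChange ℚ}
    (hC : C • W = (cm7.quadraticTwist (m : ℚ)).quadraticTwist (ε : ℚ)) :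
    ¬ W.HasGoodReductionAtPrime 2 := by
  rw [quadraticTwist_quadraticTwist, ← Int.cast_mul] at hC
  refine not_hasGoodReductionAtPrime_two_of_smul_eq_quadraticTwist cm7 W hasGoodReductionAtPrime_cm7_two
    ?_ hC
  rcases hε with rfl | rfl | rfl <;> omega

/-! ## §2 K12₂″ ⟺ the `2`-converse for the wild twists of the good family -/

/-- **K12₂″ ⟹ the wild-twist form.** For squarefree `m ≡ 1 (mod 4)`, `ε ∈ {−1, 2, −2}` and a globally
minimal `W ≅_ℚ (cm7^{(m)})^{(ε)}`: `j(W) = −3375` and `W` is not good at `2`, so the route decl applies.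
[cite: BarriosEtAl2025, Thm. 5.1] [cite: SilvermanAEC2009, X.5 Cor. 5.4] -/
theorem wildTwistsOfGoodFamily_of_rankOneTwoConverseCMSevenAdditiveTwo
    (h : Summit.BirchSwinnertonDyer.BirchSwinnertonDyer.Theses.GoldfeldAllTwistsTwoConverse.RankOneTwoConverseCMSevenAdditiveTwo) :
    ∀ (m : ℤ), Squarefree m → m % 4 = 1 → ∀ (ε : ℤ), (ε = -1 ∨ ε = 2 ∨ ε = -2) →
      ∀ (W : WeierstrassCurve ℚ) [W.IsElliptic] [W.IsGloballyMinimal] (C : VariableChange ℚ),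
        C • W = (cm7.quadraticTwist (m : ℚ)).quadraticTwist (ε : ℚ) →
        W.selmerCorank 2 = 1 → W.analyticRank = 1 := by
  intro m hsq hm ε hε W _ _ C hC hsel
  have hbad := not_hasGoodReductionAtPrime_two_of_smul_eq_wildTwist W hε hm hC
  rw [quadraticTwist_quadraticTwist, ← Int.cast_mul] at hC
  have hne : m * ε ≠ 0 := mul_ne_zero hsq.ne_zero (by rcases hε with rfl | rfl | rfl <;> decide)
  exact h W (j_eq_neg3375_of_smul_eq_quadraticTwist_cm7 W hne hC) hbad hsel

/-- **The wild-twist form ⟹ K12₂″.** A globally minimal `W` with `j(W) = −3375` not good at `2` is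
`ℚ`-isomorphic to `(cm7^{(ε)})^{(m)} = (cm7^{(m)})^{(ε)}` with `ε ∈ {−1, 2, −2}`, `m ≡ 1 (mod 4)` squarefree
(c301's `exists_baseTwist_of_j_neg3375_of_not_good_two`). [cite: SilvermanAEC2009, X.5 Cor. 5.4] -/
theorem rankOneTwoConverseCMSevenAdditiveTwo_of_wildTwistsOfGoodFamily
    (h : ∀ (m : ℤ), Squarefree m → m % 4 = 1 → ∀ (ε : ℤ), (ε = -1 ∨ ε = 2 ∨ ε = -2) →
      ∀ (W : WeierstrassCurve ℚ) [W.IsElliptic] [W.IsGloballyMinimal] (C : VariableChange ℚ),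
        C • W = (cm7.quadraticTwist (m : ℚ)).quadraticTwist (ε : ℚ) →
        W.selmerCorank 2 = 1 → W.analyticRank = 1) :
    Summit.BirchSwinnertonDyer.BirchSwinnertonDyer.Theses.GoldfeldAllTwistsTwoConverse.RankOneTwoConverseCMSevenAdditiveTwo := by
  intro W _ _ hj hg hsel
  obtain ⟨ε, m, hε, hm4, hsqm, C, hC⟩ := exists_baseTwist_of_j_neg3375_of_not_good_two W hj hg
  rw [quadraticTwist_cm7_comm] at hC
  exact h m hsqm hm4 ε hε W C hC hsel

/-- **K12₂″ ⟺ the rank-one `2^∞`-Selmer converse for the wild twists `χ_{−1}, χ_{±2}` of the good-ordinary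
`ℚ(√−7)` family** (hypothesis-free equivalence of statements). The additive cell is exactly
{globally minimal models of `(E_m)^{(ε)}` : `E_m = X₀(49)^{(m)}`, `m ≡ 1 (mod 4)` squarefree — good ordinary at
`2` —, `ε ∈ {−1, 2, −2}`}. [cite: BarriosEtAl2025, Thm. 5.1] [cite: SilvermanAEC2009, X.5 Cor. 5.4] -/
theorem rankOneTwoConverseCMSevenAdditiveTwo_iff_wildTwistsOfGoodFamily :
    Summit.BirchSwinnertonDyer.BirchSwinnertonDyer.Theses.GoldfeldAllTwistsTwoConverse.RankOneTwoConverseCMSevenAdditiveTwo ↔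
      ∀ (m : ℤ), Squarefree m → m % 4 = 1 → ∀ (ε : ℤ), (ε = -1 ∨ ε = 2 ∨ ε = -2) →
        ∀ (W : WeierstrassCurve ℚ) [W.IsElliptic] [W.IsGloballyMinimal] (C : VariableChange ℚ),
          C • W = (cm7.quadraticTwist (m : ℚ)).quadraticTwist (ε : ℚ) →
          W.selmerCorank 2 = 1 → W.analyticRank = 1 :=
  ⟨wildTwistsOfGoodFamily_of_rankOneTwoConverseCMSevenAdditiveTwo,
    rankOneTwoConverseCMSevenAdditiveTwo_of_wildTwistsOfGoodFamily⟩

end Summit.BirchSwinnertonDyer.BirchSwinnertonDyer.Theorems.GoldfeldGoodTwists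

end
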